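import Summits.Ventures.CertifiedManyBodySolver.Observables.GHFClassFloor
import Summits.Ventures.CertifiedManyBodySolver.Observables.NeelClassExclusionHalfFillingColumn
import Summits.Ventures.CertifiedManyBodySolver.Observables.NeelClassExclusionHalfFillingColumnB
import Summits.Ventures.CertifiedManyBodySolver.Observables.NeelClassExclusionDopingAxis
import Literature.MathematicalPhysics.QuantumLattice.HubbardNNNHoppingEnergyDensityMonotone
import HarnessLib

/-!
# Ventures/CertifiedManyBodySolver — Observables/GHFClassExclusionHalfFilling.lean
# The half-filled column `(U, 1, 0)`: EVERY mean-field (generalised Hartree–Fock / quasi-free) state is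
# certified-excluded as the ground state for `U/t ∈ {8} ∪ [9.7, 10] ∪ [11.4, 12] ∪ [14.6, 16]`

HONEST FRAMING: first certified bounds; not a superconductivity verdict; every number certified or labelled float.
A competing-order EXCLUSION removes a named class of candidate ground states; it never says which order is present;
no phase sentence follows.

Cell `hubbard-tc` (MO-S3, D-0096), seat `hubbard-tc-mod-3` (G3), `prover-hubbard-tc-mod-3-g9-0`. THE WORDS on the kernel
floor `GHFClassFloor.ghfClass_energy_per_site_ge(_halfFilling)` (`e ≥ -4t²/U` at half filling for the COMPLETE gHF class
X1-GHF: every state with `docc ≥ (n/2)² - mean|⟨S_x⟩|²`, hence every Slater determinant / HFB / BCS vacuum with ANY spin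
texture — Néel, stripes of any period and orientation, spirals, canted, ferro- or ferrimagnetic domains, polarons —, ANY
charge texture and ANY pairing; the class contains the cell's X1a (MF/BCS), X1b (saturated FM) and X1-AF (Néel mean
field) classes). Caps (CERTIFIED, BY HYPOTHESIS, exactly as in `NeelClassExclusionHalfFillingColumn(B).lean`): #472
`cert_r472_pb2_tl_upper_n1_U8` (`e₀(8,1,0) ≤ -0.5087724`), #471 `cert_r471_pb2_tl_upper_n1_U10` (`≤ -0.4241559`), #470
`cert_r470_pb2_tl_upper_n1_U12` (`≤ -0.3622300`), #469 `cert_r469_pb2_tl_upper_n1_U16` (`≤ -0.2788435`); U-windows below an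
anchor by monotonicity in `U` (`energyDensityTT'_mono_U`).

WORDS (gap `η`: «no state of the class on any torus `L ≥ 3` comes within `η·t` per site of the ground-state energy
density»): `ghfClass_energy_ge_U8_halfFilling` `η = 1/125` (margin `-1/2 + 0.5087724 = 0.0087724`, thin) ·
`_U10_` `1/50` (margin 0.0241559) · `_U12_` `1/40` (0.0288967) · `_U16_` `1/40` (0.0288435) · windows
`_Uwindow_97_10` EVERY `U ∈ [9.7, 10]` `1/100` · `_Uwindow_114_12` EVERY `U ∈ [11.4, 12]` `1/100` · `_Uwindow_146_16`
EVERY `U ∈ [14.6, 16]` `1/250` (the La-box far edge `14.6–14.7` is inside) · umbrella `ghfClass_energy_ge_halfFilling_Uset`.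
NOT reached: `U ≤ 6` (floor `-2/3 < cap -0.6271915` at `U = 6`; the Néel-class words of `NeelClassExclusionCubicB` /
`…HalfFillingColumnB` stand there), and every `n ≠ 1` (the universal floor carries `-(U/2)n(1-n)`).

READING: at half filling and `U/t ≥ 8` the true ground state carries CERTIFIED correlation energy `≥ 0.008–0.029·t`
per site beyond EVERY mean-field ansatz whatsoever (not only beyond the two-sublattice Néel determinant): no
Hartree–Fock, BCS or HFB state of any texture is the ground state. Exact arithmetic: `hubbard-tc-mod-3/g9-replay/`.
WHAT THIS IS NOT: a statement that antiferromagnetic (or any) ORDER is absent at half filling (it is believed present);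
a statement about the Mott gap or `T_c`; a phase word.

References: V. Bach, E. H. Lieb, J. P. Solovej, J. Stat. Phys. 76 (1994) 3, §2 eq. (2c.36), Thm. 4.5 [BachLiebSolovej1994];
D. Ruelle, *Statistical Mechanics* (1969) §3.3 [Ruelle1969].
-/

noncomputable section

namespace Summit.Ventures.CertifiedManyBodySolver.Observables

open Literature.MathematicalPhysics.QuantumLattice
open Literature.MathematicalPhysics.QuantumLattice.ThermodynamicLimit
open Summit.Ventures.CertifiedManyBodySolver.Certificates
open Matrix Finset Literature.Probability.LatticeModels
  Literature.MathematicalPhysics.QuantumLattice.RayleighBound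
  Literature.MathematicalPhysics.QuantumLattice.LangerMattis
  NeelClassFloor GHFClassFloor
open scoped ComplexOrder

variable {L : ℕ} [NeZero L]

/-- **Half filling `(8, 1, 0)` — EVERY generalised-Hartree–Fock (quasi-free) state misses `e₀` by `≥ 1/125·t`** (thin:
margin `0.0087724`; cap #472 BY HYPOTHESIS, claim node `cert_r472_pb2_tl_upper_n1_U8`; floor `-4t²/U = -1/2`).
[cite: BachLiebSolovej1994, §2 eq. (2c.36)] [cite: Ruelle1969, §3.3] -/
theorem ghfClass_energy_ge_U8_halfFilling (h472 : cert_r472_pb2_tl_upper_n1_U8) (hL : 3 ≤ L)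
    {φ : Fock (Orb (FermionTorus 2 L))} (hφ : φ ≠ 0)
    (hN : (star φ ⬝ᵥ (totalNumber *ᵥ φ)).re = 1 * (L : ℝ) ^ 2 * normSq φ)
    (hD : ((1 : ℝ) ^ 2 / 4) * (L : ℝ) ^ 2 * normSq φ * normSq φ -
        ∑ x : FermionTorus 2 L, (((star φ ⬝ᵥ ((numberOp x 0 - numberOp x 1) *ᵥ φ)).re) ^ 2 / 4 +
          ‖star φ ⬝ᵥ ((creation (orb x 0) * annihilation (orb x 1)) *ᵥ φ)‖ ^ 2) ≤
      (star φ ⬝ᵥ ((∑ x : FermionTorus 2 L, numberOp x 0 * numberOp x 1) *ᵥ φ)).re * normSq φ) :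
    energyDensityTT' 1 0 8 (1) + 1 / 125 ≤
      (star φ ⬝ᵥ (hubbardTorusTT' L 1 0 8 *ᵥ φ)).re / ((L : ℝ) ^ 2 * normSq φ) := by
  have hcap := n1_cap472_decimal_of h472
  have h := ghfClass_energy_per_site_ge_halfFilling hL 1 (U := 8) (by norm_num) hφ hN hD
  norm_num at h ⊢
  linarith

/-- **Half filling `(10, 1, 0)` — every gHF state misses `e₀` by `≥ 1/50·t`** (margin `0.0241559`; cap #471 BY HYPOTHESIS,
`cert_r471_pb2_tl_upper_n1_U10`; floor `-2/5`). [cite: BachLiebSolovej1994, §2 eq. (2c.36)] [cite: Ruelle1969, §3.3] -/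
theorem ghfClass_energy_ge_U10_halfFilling (h471 : cert_r471_pb2_tl_upper_n1_U10) (hL : 3 ≤ L)
    {φ : Fock (Orb (FermionTorus 2 L))} (hφ : φ ≠ 0)
    (hN : (star φ ⬝ᵥ (totalNumber *ᵥ φ)).re = 1 * (L : ℝ) ^ 2 * normSq φ)
    (hD : ((1 : ℝ) ^ 2 / 4) * (L : ℝ) ^ 2 * normSq φ * normSq φ -
        ∑ x : FermionTorus 2 L, (((star φ ⬝ᵥ ((numberOp x 0 - numberOp x 1) *ᵥ φ)).re) ^ 2 / 4 +
          ‖star φ ⬝ᵥ ((creation (orb x 0) * annihilation (orb x 1)) *ᵥ φ)‖ ^ 2) ≤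
      (star φ ⬝ᵥ ((∑ x : FermionTorus 2 L, numberOp x 0 * numberOp x 1) *ᵥ φ)).re * normSq φ) :
    energyDensityTT' 1 0 10 (1) + 1 / 50 ≤
      (star φ ⬝ᵥ (hubbardTorusTT' L 1 0 10 *ᵥ φ)).re / ((L : ℝ) ^ 2 * normSq φ) := by
  have hcap := u10n1_cap_decimal_of h471
  have h := ghfClass_energy_per_site_ge_halfFilling hL 1 (U := 10) (by norm_num) hφ hN hD
  norm_num at h ⊢
  linarith

/-- **Half filling `(12, 1, 0)` — every gHF state misses `e₀` by `≥ 1/40·t`** (margin `0.0288967`; cap #470 BY HYPOTHESIS,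
`cert_r470_pb2_tl_upper_n1_U12`; floor `-1/3`). [cite: BachLiebSolovej1994, §2 eq. (2c.36)] [cite: Ruelle1969, §3.3] -/
theorem ghfClass_energy_ge_U12_halfFilling (h470 : cert_r470_pb2_tl_upper_n1_U12) (hL : 3 ≤ L)
    {φ : Fock (Orb (FermionTorus 2 L))} (hφ : φ ≠ 0)
    (hN : (star φ ⬝ᵥ (totalNumber *ᵥ φ)).re = 1 * (L : ℝ) ^ 2 * normSq φ)
    (hD : ((1 : ℝ) ^ 2 / 4) * (L : ℝ) ^ 2 * normSq φ * normSq φ -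
        ∑ x : FermionTorus 2 L, (((star φ ⬝ᵥ ((numberOp x 0 - numberOp x 1) *ᵥ φ)).re) ^ 2 / 4 +
          ‖star φ ⬝ᵥ ((creation (orb x 0) * annihilation (orb x 1)) *ᵥ φ)‖ ^ 2) ≤
      (star φ ⬝ᵥ ((∑ x : FermionTorus 2 L, numberOp x 0 * numberOp x 1) *ᵥ φ)).re * normSq φ) :
    energyDensityTT' 1 0 12 (1) + 1 / 40 ≤
      (star φ ⬝ᵥ (hubbardTorusTT' L 1 0 12 *ᵥ φ)).re / ((L : ℝ) ^ 2 * normSq φ) := by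
  have hcap := u12n1_cap_decimal_of h470
  have h := ghfClass_energy_per_site_ge_halfFilling hL 1 (U := 12) (by norm_num) hφ hN hD
  norm_num at h ⊢
  linarith

/-- **Half filling `(16, 1, 0)` — every gHF state misses `e₀` by `≥ 1/40·t`** (margin `0.0288435`; cap #469 BY HYPOTHESIS,
`cert_r469_pb2_tl_upper_n1_U16`; floor `-1/4`). [cite: BachLiebSolovej1994, §2 eq. (2c.36)] [cite: Ruelle1969, §3.3] -/
theorem ghfClass_energy_ge_U16_halfFilling (h469 : cert_r469_pb2_tl_upper_n1_U16) (hL : 3 ≤ L)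
    {φ : Fock (Orb (FermionTorus 2 L))} (hφ : φ ≠ 0)
    (hN : (star φ ⬝ᵥ (totalNumber *ᵥ φ)).re = 1 * (L : ℝ) ^ 2 * normSq φ)
    (hD : ((1 : ℝ) ^ 2 / 4) * (L : ℝ) ^ 2 * normSq φ * normSq φ -
        ∑ x : FermionTorus 2 L, (((star φ ⬝ᵥ ((numberOp x 0 - numberOp x 1) *ᵥ φ)).re) ^ 2 / 4 +
          ‖star φ ⬝ᵥ ((creation (orb x 0) * annihilation (orb x 1)) *ᵥ φ)‖ ^ 2) ≤
      (star φ ⬝ᵥ ((∑ x : FermionTorus 2 L, numberOp x 0 * numberOp x 1) *ᵥ φ)).re * normSq φ) :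
    energyDensityTT' 1 0 16 (1) + 1 / 40 ≤
      (star φ ⬝ᵥ (hubbardTorusTT' L 1 0 16 *ᵥ φ)).re / ((L : ℝ) ^ 2 * normSq φ) := by
  have hcap := u16n1_cap_decimal_of h469
  have h := ghfClass_energy_per_site_ge_halfFilling hL 1 (U := 16) (by norm_num) hφ hN hD
  norm_num at h ⊢
  linarith

/-- **Window `U ∈ [9.7, 10]` at half filling — every gHF state misses `e₀` by `≥ 1/100·t`** (cap #471 read DOWN by monotonicity in `U`;
floor `-4/U ≥ -4/9.7`; margin `0.0018` at `U = 9.7`). [cite: BachLiebSolovej1994, §2 eq. (2c.36)] [cite: Ruelle1969, §3.3] -/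
theorem ghfClass_energy_ge_halfFilling_Uwindow_97_10 (h471 : cert_r471_pb2_tl_upper_n1_U10) (hL : 3 ≤ L) {U : ℝ}
    (hU1 : 97 / 10 ≤ U) (hU2 : U ≤ 10)
    {φ : Fock (Orb (FermionTorus 2 L))} (hφ : φ ≠ 0)
    (hN : (star φ ⬝ᵥ (totalNumber *ᵥ φ)).re = 1 * (L : ℝ) ^ 2 * normSq φ)
    (hD : ((1 : ℝ) ^ 2 / 4) * (L : ℝ) ^ 2 * normSq φ * normSq φ -
        ∑ x : FermionTorus 2 L, (((star φ ⬝ᵥ ((numberOp x 0 - numberOp x 1) *ᵥ φ)).re) ^ 2 / 4 +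
          ‖star φ ⬝ᵥ ((creation (orb x 0) * annihilation (orb x 1)) *ᵥ φ)‖ ^ 2) ≤
      (star φ ⬝ᵥ ((∑ x : FermionTorus 2 L, numberOp x 0 * numberOp x 1) *ᵥ φ)).re * normSq φ) :
    energyDensityTT' 1 0 U (1) + 1 / 100 ≤
      (star φ ⬝ᵥ (hubbardTorusTT' L 1 0 U *ᵥ φ)).re / ((L : ℝ) ^ 2 * normSq φ) := by
  have hUpos : 0 < U := by linarith
  have hcap : energyDensityTT' 1 0 U (1 : ℝ) ≤ -0.4241559431 :=
    (energyDensityTT'_mono_U 1 0 (by norm_num : (0:ℝ) ≤ 1) (by norm_num) hUpos.le hU2).trans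
      (u10n1_cap_decimal_of h471)
  have h := ghfClass_energy_per_site_ge_halfFilling hL 1 hUpos hφ hN hD
  have h4 : -0.4241559431 + 1 / 100 ≤ -4 * (1 : ℝ) ^ 2 / U := by
    rw [le_div_iff₀ hUpos]
    linarith
  linarith

/-- **Window `U ∈ [11.4, 12]` at half filling — every gHF state misses `e₀` by `≥ 1/100·t`** (cap #470 read down; margin `0.0013`
at `U = 11.4`). [cite: BachLiebSolovej1994, §2 eq. (2c.36)] [cite: Ruelle1969, §3.3] -/
theorem ghfClass_energy_ge_halfFilling_Uwindow_114_12 (h470 : cert_r470_pb2_tl_upper_n1_U12) (hL : 3 ≤ L) {U : ℝ}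
    (hU1 : 57 / 5 ≤ U) (hU2 : U ≤ 12)
    {φ : Fock (Orb (FermionTorus 2 L))} (hφ : φ ≠ 0)
    (hN : (star φ ⬝ᵥ (totalNumber *ᵥ φ)).re = 1 * (L : ℝ) ^ 2 * normSq φ)
    (hD : ((1 : ℝ) ^ 2 / 4) * (L : ℝ) ^ 2 * normSq φ * normSq φ -
        ∑ x : FermionTorus 2 L, (((star φ ⬝ᵥ ((numberOp x 0 - numberOp x 1) *ᵥ φ)).re) ^ 2 / 4 +
          ‖star φ ⬝ᵥ ((creation (orb x 0) * annihilation (orb x 1)) *ᵥ φ)‖ ^ 2) ≤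
      (star φ ⬝ᵥ ((∑ x : FermionTorus 2 L, numberOp x 0 * numberOp x 1) *ᵥ φ)).re * normSq φ) :
    energyDensityTT' 1 0 U (1) + 1 / 100 ≤
      (star φ ⬝ᵥ (hubbardTorusTT' L 1 0 U *ᵥ φ)).re / ((L : ℝ) ^ 2 * normSq φ) := by
  have hUpos : 0 < U := by linarith
  have hcap : energyDensityTT' 1 0 U (1 : ℝ) ≤ -0.3622300252 :=
    (energyDensityTT'_mono_U 1 0 (by norm_num : (0:ℝ) ≤ 1) (by norm_num) hUpos.le hU2).trans
      (u12n1_cap_decimal_of h470)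
  have h := ghfClass_energy_per_site_ge_halfFilling hL 1 hUpos hφ hN hD
  have h4 : -0.3622300252 + 1 / 100 ≤ -4 * (1 : ℝ) ^ 2 / U := by
    rw [le_div_iff₀ hUpos]
    linarith
  linarith

/-- **Window `U ∈ [14.6, 16]` at half filling — every gHF state misses `e₀` by `≥ 1/250·t`** (cap #469 read down; margin `0.0009`
at `U = 14.6`; the window contains the far `U`-edge `14.6–14.7` of the La₂CuO₄ object-E box). [cite: BachLiebSolovej1994, §2 eq. (2c.36)]
[cite: Ruelle1969, §3.3] -/
theorem ghfClass_energy_ge_halfFilling_Uwindow_146_16 (h469 : cert_r469_pb2_tl_upper_n1_U16) (hL : 3 ≤ L) {U : ℝ}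
    (hU1 : 73 / 5 ≤ U) (hU2 : U ≤ 16)
    {φ : Fock (Orb (FermionTorus 2 L))} (hφ : φ ≠ 0)
    (hN : (star φ ⬝ᵥ (totalNumber *ᵥ φ)).re = 1 * (L : ℝ) ^ 2 * normSq φ)
    (hD : ((1 : ℝ) ^ 2 / 4) * (L : ℝ) ^ 2 * normSq φ * normSq φ -
        ∑ x : FermionTorus 2 L, (((star φ ⬝ᵥ ((numberOp x 0 - numberOp x 1) *ᵥ φ)).re) ^ 2 / 4 +
          ‖star φ ⬝ᵥ ((creation (orb x 0) * annihilation (orb x 1)) *ᵥ φ)‖ ^ 2) ≤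
      (star φ ⬝ᵥ ((∑ x : FermionTorus 2 L, numberOp x 0 * numberOp x 1) *ᵥ φ)).re * normSq φ) :
    energyDensityTT' 1 0 U (1) + 1 / 250 ≤
      (star φ ⬝ᵥ (hubbardTorusTT' L 1 0 U *ᵥ φ)).re / ((L : ℝ) ^ 2 * normSq φ) := by
  have hUpos : 0 < U := by linarith
  have hcap : energyDensityTT' 1 0 U (1 : ℝ) ≤ -0.2788435215 :=
    (energyDensityTT'_mono_U 1 0 (by norm_num : (0:ℝ) ≤ 1) (by norm_num) hUpos.le hU2).trans
      (u16n1_cap_decimal_of h469)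
  have h := ghfClass_energy_per_site_ge_halfFilling hL 1 hUpos hφ hN hD
  have h4 : -0.2788435215 + 1 / 250 ≤ -4 * (1 : ℝ) ^ 2 / U := by
    rw [le_div_iff₀ hUpos]
    linarith
  linarith

/-- **UMBRELLA — the half-filled column against ALL of mean-field theory.** For every `U/t ∈ {8} ∪ [9.7, 10] ∪ [11.4, 12] ∪ [14.6, 16]`
(caps #472, #471, #470, #469 BY HYPOTHESIS) no state of the complete gHF class — no Slater determinant, BCS or HFB vacuum of ANY
spin / charge / pairing texture — on any torus `L ≥ 3` comes within `1/250·t` per site of the ground-state energy density at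
half filling. [cite: BachLiebSolovej1994, §2 eq. (2c.36), Thm. 4.5] [cite: Ruelle1969, §3.3] -/
theorem ghfClass_energy_ge_halfFilling_Uset (h472 : cert_r472_pb2_tl_upper_n1_U8) (h471 : cert_r471_pb2_tl_upper_n1_U10)
    (h470 : cert_r470_pb2_tl_upper_n1_U12) (h469 : cert_r469_pb2_tl_upper_n1_U16) (hL : 3 ≤ L) {U : ℝ}
    (hU : U = 8 ∨ (97 / 10 ≤ U ∧ U ≤ 10) ∨ (57 / 5 ≤ U ∧ U ≤ 12) ∨ (73 / 5 ≤ U ∧ U ≤ 16))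
    {φ : Fock (Orb (FermionTorus 2 L))} (hφ : φ ≠ 0)
    (hN : (star φ ⬝ᵥ (totalNumber *ᵥ φ)).re = 1 * (L : ℝ) ^ 2 * normSq φ)
    (hD : ((1 : ℝ) ^ 2 / 4) * (L : ℝ) ^ 2 * normSq φ * normSq φ -
        ∑ x : FermionTorus 2 L, (((star φ ⬝ᵥ ((numberOp x 0 - numberOp x 1) *ᵥ φ)).re) ^ 2 / 4 +
          ‖star φ ⬝ᵥ ((creation (orb x 0) * annihilation (orb x 1)) *ᵥ φ)‖ ^ 2) ≤
      (star φ ⬝ᵥ ((∑ x : FermionTorus 2 L, numberOp x 0 * numberOp x 1) *ᵥ φ)).re * normSq φ) :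
    energyDensityTT' 1 0 U (1) + 1 / 250 ≤
      (star φ ⬝ᵥ (hubbardTorusTT' L 1 0 U *ᵥ φ)).re / ((L : ℝ) ^ 2 * normSq φ) := by
  rcases hU with h8 | ⟨h1, h2⟩ | ⟨h1, h2⟩ | ⟨h1, h2⟩
  · subst h8
    have h := ghfClass_energy_ge_U8_halfFilling h472 hL hφ hN hD
    linarith
  · have h := ghfClass_energy_ge_halfFilling_Uwindow_97_10 h471 hL h1 h2 hφ hN hD
    linarith
  · have h := ghfClass_energy_ge_halfFilling_Uwindow_114_12 h470 hL h1 h2 hφ hN hD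
    linarith
  · exact ghfClass_energy_ge_halfFilling_Uwindow_146_16 h469 hL h1 h2 hφ hN hD

end Summit.Ventures.CertifiedManyBodySolver.Observables

end
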